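import Summits.CriticalPhenomena.Ising3DConformalLimit.Theses.LatticeSDPCertificates
import Summits.CriticalPhenomena.Ising3DConformalLimit.Theorems.PerfectScreeningNonSaturation
import Literature.Probability.LatticeModels.PointwiseScalingLimitEtaExists
import Literature.Probability.LatticeModels.IsingExponents
import HarnessLib

/-!
# Route `LatticeSDPCertificates`, support item `WindowBelowHalf` (stmt-CriticalPhenomena-5507):
# structure lemmas

`WindowBelowHalf` (WINDOW) is the statement
`∃ ε c > 0, ∀ 1 ≤ m ≤ n, c (n/m)^{-(3/2-ε)} G(m e₁) ≤ G(n e₁)` for the critical two-point function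
`G = criticalTwoPoint 3 = ⟨σ₀σ_x⟩⁺_{β_c(3)}` of the nearest-neighbour Ising model on `ℤ³`: along a
lattice axis the two-point function never loses more than the power `3/2 - ε` between two scales
("`η_eff < 1/2` at every scale"). It is an OPEN PROBLEM in print: the best pointwise information is
`c‖x‖⁻² ≤ G(x) ≤ C‖x‖⁻¹` (`criticalTwoPoint_bounds_holds`; Simon–Lieb 1980, Fröhlich–Simon–Spencer
1976), the lower bounds of Duminil-Copin–Panis 2025 (Thms 1.2, 1.3, 1.5, 1.8, all in the tree) are
averaged statements (`η ≤ 1/2` IF `η` exists; bubble divergence), and Aizenman–Duminil-Copin 2021,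
Remark 5.10, name exactly the missing step ("a proof that `S(ne₁)` does not drop too fast between
different scales"). Even axial two-point DOUBLING `G(2n e₁) ≥ κ G(n e₁)`, which WINDOW implies at
once, is recorded as open in the tree (`CriticalAxisRatioRegularity`, `CriticalTwoPointDCPLower`).
Nothing in this file proves or refutes WINDOW; it records, sorry-free, its exact logical position
(helper file, `--supports stmt-CriticalPhenomena-5507`):

* `windowBelowHalf_of_axis_rpow_bounds`, `windowBelowHalf_of_hasIsingEtaBounds`: WINDOW follows
  from two-sided pure-power bounds along the axis with ONE exponent `a < 3/2`, in particular from
  `HasIsingEtaBounds 3 η` with `η < 1/2` (the standard conjecture in its up-to-constants form;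
  conformal bootstrap `η(3) = 2Δ_σ - 1 ≈ 0.0363`, Poland–Rychkov–Vichi 2019, §V.B).
* `not_windowBelowHalf_of_axis_upper`, `not_windowBelowHalf_of_hasIsingEtaBounds_half`: conversely
  an axial upper bound `G(n e₁) ≤ C n^{-3/2}` — the boundary case `η = 1/2`, NOT excluded by
  anything in print (it is compatible with `η ≤ 1/2` and with the logarithmic divergence of the
  bubble diagram) — refutes WINDOW: the printed `η ≤ 1/2` is exactly one `ε` short of the item.
* `axis_rpow_lower_of_windowBelowHalf`: WINDOW forces the pointwise axial lower bound
  `G(n e₁) ≥ c n^{-(3/2-ε)}` (take `m = 1`), an `n^ε`-improvement of the `‖x‖^{-3/2}` mark that no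
  printed argument reaches (pointwise one only has `c n⁻²`).
* `criticalTwoPoint_axis_scaleFactor_iterate`, `windowBelowHalf_of_scaleFactor`,
  `scaleFactor_of_windowBelowHalf`, `windowBelowHalf_iff_scaleFactor`: **WINDOW is a statement
  about a single scale factor** — it holds iff for SOME integer `q ≥ 2` the `q`-adic axial ratio is
  bounded below, uniformly in `n ≥ 1`, by a constant STRICTLY above the threshold `q^{-3/2}`:
  `∃ q ≥ 2, ∃ κ > q^{-3/2}, ∀ n ≥ 1, G(q n e₁) ≥ κ G(n e₁)` (`⇐`: `κ = q^{-θ}`, `0 ≤ θ < 3/2`,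
  iterate and fill in between the scales `q^j m` by the Messager–Miracle-Solé monotonicity
  `criticalTwoPoint_axis_antitone`; `⇒`: take `q` with `c q^ε > 1`). This is the finite-depth form
  an `R`-uniform lattice-bootstrap certificate of the route (`CertifiedWindow`) has to deliver.
* `isingEta_lt_half_of_windowBelowHalf`: WINDOW ⇒ (`HasIsingExponentEta 3 η → η < 1/2`), the
  STRICT form of Duminil-Copin–Panis 2025, Thm 1.5 (`dcp_isingEta_le_half_holds`: `η ≤ 1/2`).
* `windowBelowHalf_of_certifiedWindow`: the milestone reading `CertifiedWindow →
  CriticalStateFeasible → WindowBelowHalf` (items 5504, 5506 ⇒ 5507), the inner step of `closes`.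

References: M. Aizenman, H. Duminil-Copin, Ann. of Math. 194 (2021), arXiv:1912.07973, §5.6,
Remark 5.10 [AizenmanDuminilCopinAnnals2021]; H. Duminil-Copin, R. Panis, Comm. Math. Phys. 406
(2025), arXiv:2404.05700, Thms 1.3, 1.5, 1.8 [DuminilCopinPanis2025LowerBounds]; A. Messager,
S. Miracle-Solé, J. Stat. Phys. 17 (1977) [MessagerMiracleSoleJSP1977]; D. Poland, S. Rychkov,
A. Vichi, Rev. Mod. Phys. 91 (2019), §V.B [PolandRychkovVichi2019].
-/

noncomputable section

namespace Summit.CriticalPhenomena.Ising3DConformalLimit.Theorems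

open Literature.Probability.LatticeModels Filter Topology MeasureTheory
open Summit.CriticalPhenomena.Ising3DConformalLimit.Theses.LatticeSDPCertificates

/-! ### WINDOW from axial power bounds with a common exponent below `3/2` -/

/-- **Pure power bounds along the axis with one exponent `a < 3/2` give WINDOW**: if
`c n^{-a} ≤ G(n e₁) ≤ C n^{-a}` for all `n ≥ 1` with `a < 3/2`, then
`G(n e₁)/G(m e₁) ≥ (c/C)(m/n)^{a} ≥ (c/C)(m/n)^{3/2-ε}`, `ε = 3/2 - a`. [folklore] -/
theorem windowBelowHalf_of_axis_rpow_bounds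
    (h : ∃ a c C : ℝ, a < 3 / 2 ∧ 0 < c ∧ ∀ n : ℕ, 1 ≤ n →
      c * (n : ℝ) ^ (-a) ≤ criticalTwoPoint 3 (Pi.single 0 (n : ℤ)) ∧
        criticalTwoPoint 3 (Pi.single 0 (n : ℤ)) ≤ C * (n : ℝ) ^ (-a)) :
    WindowBelowHalf := by
  unfold WindowBelowHalf
  obtain ⟨a, c, C, ha, hc, hb⟩ := h
  have hC : 0 < C := by
    obtain ⟨h1, h2⟩ := hb 1 le_rfl
    have h12 := h1.trans h2
    simp only [Nat.cast_one, Real.one_rpow, mul_one] at h12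
    linarith
  refine ⟨3 / 2 - a, c / C, by linarith, div_pos hc hC, fun m n hm hmn => ?_⟩
  have hm0 : (0 : ℝ) < m := by exact_mod_cast hm
  have hn1 : 1 ≤ n := hm.trans hmn
  have hn0 : (0 : ℝ) < n := by exact_mod_cast hn1
  have hexp : -((3 : ℝ) / 2 - (3 / 2 - a)) = -a := by ring
  rw [hexp, Real.div_rpow hn0.le hm0.le]
  obtain ⟨hlow, -⟩ := hb n hn1
  obtain ⟨-, hup⟩ := hb m hm
  have hma : (0 : ℝ) < (m : ℝ) ^ (-a) := Real.rpow_pos_of_pos hm0 _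
  have hCne : C ≠ 0 := hC.ne'
  have hmane : (m : ℝ) ^ (-a) ≠ 0 := hma.ne'
  calc c / C * ((n : ℝ) ^ (-a) / (m : ℝ) ^ (-a)) * criticalTwoPoint 3 (Pi.single 0 (m : ℤ))
      ≤ c / C * ((n : ℝ) ^ (-a) / (m : ℝ) ^ (-a)) * (C * (m : ℝ) ^ (-a)) := by gcongr
    _ = c * (n : ℝ) ^ (-a) := by field_simp
    _ ≤ criticalTwoPoint 3 (Pi.single 0 (n : ℤ)) := hlow

/-- **`η < 1/2` with two-sided bounds gives WINDOW**: `HasIsingEtaBounds 3 η`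
(`c‖x‖^{-(1+η)} ≤ G(x) ≤ C‖x‖^{-(1+η)}`, `x ≠ 0`) with `η < 1/2` implies `WindowBelowHalf`
(restrict to the axis, `‖n e₁‖ = n`, exponent `1 + η < 3/2`). The conformal-bootstrap value is
`η(3) ≈ 0.0363`. [folklore] -/
theorem windowBelowHalf_of_hasIsingEtaBounds {η : ℝ} (hη : η < 1 / 2)
    (h : HasIsingEtaBounds 3 η) : WindowBelowHalf := by
  unfold HasIsingEtaBounds IsPowerBounded at h
  obtain ⟨c, C, hc, hbd⟩ := h
  have he : (-(((3 : ℕ) : ℝ) - 2 + η)) = -(1 + η) := by norm_num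
  refine windowBelowHalf_of_axis_rpow_bounds ⟨1 + η, c, C, by linarith, hc, fun n hn => ?_⟩
  have hx := hbd _ (single_natCast_ne_zero hn)
  rw [he, norm_single_natCast] at hx
  exact hx

/-! ### What WINDOW forces along the axis -/

/-- **WINDOW forces `G(n e₁) ≥ c n^{-(3/2-ε)}`** (the case `m = 1`; `G(e₁) > 0` by the Simon–Lieb
lower bound): a pointwise `n^ε`-improvement of the `n^{-3/2}` mark, beyond every printed lower
bound for `d = 3`. [folklore] -/
theorem axis_rpow_lower_of_windowBelowHalf (h : WindowBelowHalf) :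
    ∃ ε c : ℝ, 0 < ε ∧ 0 < c ∧ ∀ n : ℕ, 1 ≤ n →
      c * (n : ℝ) ^ (-((3 : ℝ) / 2 - ε)) ≤ criticalTwoPoint 3 (Pi.single 0 (n : ℤ)) := by
  unfold WindowBelowHalf at h
  obtain ⟨ε, c, hε, hc, hw⟩ := h
  have hg1 : 0 < criticalTwoPoint 3 (Pi.single 0 (1 : ℤ)) := by
    exact_mod_cast criticalTwoPoint_axis_pos 1
  refine ⟨ε, c * criticalTwoPoint 3 (Pi.single 0 (1 : ℤ)), hε, mul_pos hc hg1, fun n hn => ?_⟩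
  have h1 := hw 1 n le_rfl hn
  simp only [Nat.cast_one, div_one] at h1
  calc c * criticalTwoPoint 3 (Pi.single 0 (1 : ℤ)) * (n : ℝ) ^ (-((3 : ℝ) / 2 - ε))
      = c * (n : ℝ) ^ (-((3 : ℝ) / 2 - ε)) * criticalTwoPoint 3 (Pi.single 0 (1 : ℤ)) := by ring
    _ ≤ criticalTwoPoint 3 (Pi.single 0 (n : ℤ)) := h1

/-- **An axial upper bound with exponent `3/2` refutes WINDOW**: if `G(n e₁) ≤ C n^{-3/2}` for all
`n ≥ 1` then `WindowBelowHalf` fails (with the lower bound it forces, `c n^ε ≤ C` for all `n`).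
So the boundary case "`η_eff = 1/2`", compatible with every printed bound (`η ≤ 1/2` if `η`
exists; logarithmic divergence of the bubble diagram), is what the item excludes. [folklore] -/
theorem not_windowBelowHalf_of_axis_upper
    (h : ∃ C : ℝ, ∀ n : ℕ, 1 ≤ n →
      criticalTwoPoint 3 (Pi.single 0 (n : ℤ)) ≤ C * (n : ℝ) ^ (-((3 : ℝ) / 2))) :
    ¬ WindowBelowHalf := by
  intro hW
  obtain ⟨C, hC⟩ := h
  obtain ⟨ε, c, hε, hc, hlow⟩ := axis_rpow_lower_of_windowBelowHalf hW
  have hbound : ∀ n : ℕ, 1 ≤ n → c * (n : ℝ) ^ ε ≤ C := by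
    intro n hn
    have hn0 : (0 : ℝ) < n := by exact_mod_cast hn
    have h1 := (hlow n hn).trans (hC n hn)
    have hsplit : (n : ℝ) ^ (-((3 : ℝ) / 2 - ε)) = (n : ℝ) ^ ε * (n : ℝ) ^ (-((3 : ℝ) / 2)) := by
      rw [← Real.rpow_add hn0]; congr 1; ring
    rw [hsplit, ← mul_assoc] at h1
    exact le_of_mul_le_mul_right h1 (Real.rpow_pos_of_pos hn0 _)
  have htend : Tendsto (fun n : ℕ => c * (n : ℝ) ^ ε) atTop atTop :=
    Tendsto.const_mul_atTop hc ((tendsto_rpow_atTop hε).comp tendsto_natCast_atTop_atTop)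
  obtain ⟨n, hn⟩ := ((htend.eventually_gt_atTop C).and (eventually_ge_atTop 1)).exists
  exact absurd (hbound n hn.2) (not_le.2 hn.1)

/-- **`η = 1/2` with two-sided bounds refutes WINDOW**: `HasIsingEtaBounds 3 (1/2)`
(`G ≍ ‖x‖^{-3/2}`) implies `¬ WindowBelowHalf` (only the upper half is used). Together with
`windowBelowHalf_of_hasIsingEtaBounds`: on the pure-power scenarios `HasIsingEtaBounds 3 η`,
`η ≤ 1/2` (all that Duminil-Copin–Panis 2025, Thm 1.5 leaves), WINDOW holds iff `η < 1/2`.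
[folklore] -/
theorem not_windowBelowHalf_of_hasIsingEtaBounds_half (h : HasIsingEtaBounds 3 (1 / 2)) :
    ¬ WindowBelowHalf := by
  unfold HasIsingEtaBounds IsPowerBounded at h
  obtain ⟨c, C, -, hbd⟩ := h
  have he : (-(((3 : ℕ) : ℝ) - 2 + 1 / 2)) = -((3 : ℝ) / 2) := by norm_num
  refine not_windowBelowHalf_of_axis_upper ⟨C, fun n hn => ?_⟩
  have hx := (hbd _ (single_natCast_ne_zero hn)).2
  rw [he, norm_single_natCast] at hx
  exact hx

/-! ### WINDOW is a statement about one scale factor -/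

/-- Iterating a uniform `q`-adic ratio bound along the axis: if `κ G(n e₁) ≤ G(q n e₁)` for all
`n ≥ 1` (`κ ≥ 0`, `q ≥ 1`), then `κ^j G(n e₁) ≤ G(q^j n e₁)`. [folklore] -/
theorem criticalTwoPoint_axis_scaleFactor_iterate {q : ℕ} {κ : ℝ} (hq : 1 ≤ q) (hκ : 0 ≤ κ)
    (h : ∀ n : ℕ, 1 ≤ n → κ * criticalTwoPoint 3 (Pi.single 0 (n : ℤ)) ≤
      criticalTwoPoint 3 (Pi.single 0 ((q * n : ℕ) : ℤ)))
    (j n : ℕ) (hn : 1 ≤ n) :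
    κ ^ j * criticalTwoPoint 3 (Pi.single 0 (n : ℤ)) ≤
      criticalTwoPoint 3 (Pi.single 0 ((q ^ j * n : ℕ) : ℤ)) := by
  induction j with
  | zero => simp
  | succ j ih =>
    have hqj : 1 ≤ q ^ j * n := Nat.mul_pos (Nat.pow_pos (by omega)) hn
    calc κ ^ (j + 1) * criticalTwoPoint 3 (Pi.single 0 (n : ℤ))
        = κ * (κ ^ j * criticalTwoPoint 3 (Pi.single 0 (n : ℤ))) := by ring
      _ ≤ κ * criticalTwoPoint 3 (Pi.single 0 ((q ^ j * n : ℕ) : ℤ)) :=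
          mul_le_mul_of_nonneg_left ih hκ
      _ ≤ criticalTwoPoint 3 (Pi.single 0 ((q * (q ^ j * n) : ℕ) : ℤ)) := h _ hqj
      _ = criticalTwoPoint 3 (Pi.single 0 ((q ^ (j + 1) * n : ℕ) : ℤ)) := by
          rw [show q * (q ^ j * n) = q ^ (j + 1) * n by ring]

/-- **One scale factor suffices** (`⇐` of `windowBelowHalf_iff_scaleFactor`): if for some integer
`q ≥ 2` and some `κ > q^{-3/2}` one has `G(q n e₁) ≥ κ G(n e₁)` for all `n ≥ 1`, then WINDOW
holds — write `κ = q^{-θ}` (`0 ≤ θ < 3/2` since `κ ≤ 1` by monotonicity), iterate to the scales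
`q^j m`, and fill in between them by the Messager–Miracle-Solé monotonicity of `n ↦ G(n e₁)`;
the constants are `ε = 3/2 - θ`, `c = κ`. [folklore] -/
theorem windowBelowHalf_of_scaleFactor
    (h : ∃ (q : ℕ) (κ : ℝ), 2 ≤ q ∧ (q : ℝ) ^ (-((3 : ℝ) / 2)) < κ ∧
      ∀ n : ℕ, 1 ≤ n → κ * criticalTwoPoint 3 (Pi.single 0 (n : ℤ)) ≤
        criticalTwoPoint 3 (Pi.single 0 ((q * n : ℕ) : ℤ))) :
    WindowBelowHalf := by
  unfold WindowBelowHalf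
  obtain ⟨q, κ, hq, hqκ, h⟩ := h
  have hGpos : ∀ k : ℕ, 0 < criticalTwoPoint 3 (Pi.single 0 (k : ℤ)) :=
    fun k => criticalTwoPoint_axis_pos k
  have hGanti : Antitone fun k : ℕ => criticalTwoPoint 3 (Pi.single 0 (k : ℤ)) :=
    criticalTwoPoint_axis_antitone
  have hq1 : (1 : ℝ) < q := by exact_mod_cast hq
  have hq0 : (0 : ℝ) < q := by linarith
  have hκ0 : 0 < κ := lt_trans (Real.rpow_pos_of_pos hq0 _) hqκ
  have hκ1 : κ ≤ 1 := by
    have h1 : κ * criticalTwoPoint 3 (Pi.single 0 ((1 : ℕ) : ℤ)) ≤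
        criticalTwoPoint 3 (Pi.single 0 ((q * 1 : ℕ) : ℤ)) := h 1 le_rfl
    have h2 : criticalTwoPoint 3 (Pi.single 0 ((q * 1 : ℕ) : ℤ)) ≤
        criticalTwoPoint 3 (Pi.single 0 ((1 : ℕ) : ℤ)) := hGanti (show 1 ≤ q * 1 by omega)
    have hG1 := hGpos 1
    nlinarith [h1.trans h2]
  -- the exponent `θ` with `q^{-θ} = κ`
  obtain ⟨θ, hθκ, hθ0, hθlt⟩ : ∃ θ : ℝ, (q : ℝ) ^ (-θ) = κ ∧ 0 ≤ θ ∧ θ < 3 / 2 := by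
    refine ⟨-Real.logb q κ, ?_, ?_, ?_⟩
    · rw [neg_neg, Real.rpow_logb hq0 hq1.ne' hκ0]
    · linarith [Real.logb_nonpos hq1 hκ0.le hκ1]
    · have : -((3 : ℝ) / 2) < Real.logb q κ := (Real.lt_logb_iff_rpow_lt hq1 hκ0).2 hqκ
      linarith
  refine ⟨3 / 2 - θ, κ, by linarith, hκ0, fun m n hm hmn => ?_⟩
  have hexp : -((3 : ℝ) / 2 - (3 / 2 - θ)) = -θ := by ring
  rw [hexp]
  have hm0 : (0 : ℝ) < m := by exact_mod_cast hm
  -- the least `j` with `n ≤ q^j m`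
  have hex : ∃ j : ℕ, n ≤ q ^ j * m := by
    refine ⟨n, ?_⟩
    calc n ≤ 2 ^ n := Nat.lt_two_pow_self.le
      _ ≤ q ^ n := Nat.pow_le_pow_left hq n
      _ ≤ q ^ n * m := Nat.le_mul_of_pos_right _ hm
  obtain ⟨j, hj, hjmin⟩ : ∃ j : ℕ, n ≤ q ^ j * m ∧ ∀ i : ℕ, i < j → ¬ n ≤ q ^ i * m :=
    ⟨Nat.find hex, Nat.find_spec hex, fun i hi => Nat.find_min hex hi⟩
  have hiter : κ ^ j * criticalTwoPoint 3 (Pi.single 0 (m : ℤ)) ≤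
      criticalTwoPoint 3 (Pi.single 0 ((q ^ j * m : ℕ) : ℤ)) :=
    criticalTwoPoint_axis_scaleFactor_iterate (by omega) hκ0.le h j m hm
  have hmono : criticalTwoPoint 3 (Pi.single 0 ((q ^ j * m : ℕ) : ℤ)) ≤
      criticalTwoPoint 3 (Pi.single 0 (n : ℤ)) := hGanti hj
  have hkey : κ * ((n : ℝ) / m) ^ (-θ) ≤ κ ^ j := by
    rcases Nat.eq_zero_or_pos j with hj0 | hjpos
    · -- `j = 0`: `n ≤ m`, so `n = m`
      subst hj0
      have hnm : n = m := le_antisymm (by simpa using hj) hmn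
      rw [pow_zero, hnm, div_self hm0.ne', Real.one_rpow, mul_one]
      exact hκ1
    · -- `j ≥ 1`: `q^(j-1) m < n` by minimality, so `(n/m)^{-θ} ≤ (q^{j-1})^{-θ} = κ^{j-1}`
      have hlt : q ^ (j - 1) * m < n := by
        have := hjmin (j - 1) (by omega)
        omega
      have hle : ((q : ℝ) ^ (j - 1) : ℝ) ≤ (n : ℝ) / m := by
        rw [le_div_iff₀ hm0]; exact_mod_cast hlt.le
      have hqj0 : (0 : ℝ) < (q : ℝ) ^ (j - 1) := by positivity
      have h1 : ((n : ℝ) / m) ^ (-θ) ≤ ((q : ℝ) ^ (j - 1)) ^ (-θ) :=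
        Real.rpow_le_rpow_of_nonpos hqj0 hle (by linarith)
      have h2 : ((q : ℝ) ^ (j - 1)) ^ (-θ) = κ ^ (j - 1) := by
        rw [← hθκ, ← Real.rpow_natCast (q : ℝ) (j - 1), ← Real.rpow_mul hq0.le,
          ← Real.rpow_natCast ((q : ℝ) ^ (-θ)) (j - 1), ← Real.rpow_mul hq0.le]
        congr 1; ring
      calc κ * ((n : ℝ) / m) ^ (-θ) ≤ κ * κ ^ (j - 1) := by
            rw [← h2]; exact mul_le_mul_of_nonneg_left h1 hκ0.le
        _ = κ ^ j := by rw [← pow_succ', Nat.sub_add_cancel hjpos]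
  calc κ * ((n : ℝ) / m) ^ (-θ) * criticalTwoPoint 3 (Pi.single 0 (m : ℤ))
      ≤ κ ^ j * criticalTwoPoint 3 (Pi.single 0 (m : ℤ)) :=
        mul_le_mul_of_nonneg_right hkey (hGpos m).le
    _ ≤ criticalTwoPoint 3 (Pi.single 0 ((q ^ j * m : ℕ) : ℤ)) := hiter
    _ ≤ criticalTwoPoint 3 (Pi.single 0 (n : ℤ)) := hmono

/-- **WINDOW gives a scale factor** (`⇒` of `windowBelowHalf_iff_scaleFactor`): from
`(ε, c)` take an integer `q ≥ 2` with `c q^ε > 1`; then `κ := c q^{-(3/2-ε)} > q^{-3/2}` and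
WINDOW between `n` and `q n` reads `κ G(n e₁) ≤ G(q n e₁)`. [folklore] -/
theorem scaleFactor_of_windowBelowHalf (h : WindowBelowHalf) :
    ∃ (q : ℕ) (κ : ℝ), 2 ≤ q ∧ (q : ℝ) ^ (-((3 : ℝ) / 2)) < κ ∧
      ∀ n : ℕ, 1 ≤ n → κ * criticalTwoPoint 3 (Pi.single 0 (n : ℤ)) ≤
        criticalTwoPoint 3 (Pi.single 0 ((q * n : ℕ) : ℤ)) := by
  unfold WindowBelowHalf at h
  obtain ⟨ε, c, hε, hc, hw⟩ := h
  obtain ⟨q₀, hq₀⟩ := exists_nat_gt (c⁻¹ ^ ε⁻¹)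
  have hq0 : (0 : ℝ) < ((q₀ + 2 : ℕ) : ℝ) := by positivity
  refine ⟨q₀ + 2, c * ((q₀ + 2 : ℕ) : ℝ) ^ (-((3 : ℝ) / 2 - ε)), by omega, ?_, fun n hn => ?_⟩
  · -- threshold: `q^{-3/2} < c q^{-(3/2-ε)} = (c q^ε) q^{-3/2}` as `c q^ε > 1`
    have hcq : 1 < c * ((q₀ + 2 : ℕ) : ℝ) ^ ε := by
      have hlt : c⁻¹ ^ ε⁻¹ < ((q₀ + 2 : ℕ) : ℝ) := hq₀.trans_le (by push_cast; linarith)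
      have h1 : (c⁻¹ ^ ε⁻¹) ^ ε < ((q₀ + 2 : ℕ) : ℝ) ^ ε :=
        Real.rpow_lt_rpow (by positivity) hlt hε
      rw [Real.rpow_inv_rpow (by positivity) hε.ne'] at h1
      have h2 := mul_lt_mul_of_pos_left h1 hc
      rwa [mul_inv_cancel₀ hc.ne'] at h2
    have hsplit : ((q₀ + 2 : ℕ) : ℝ) ^ (-((3 : ℝ) / 2 - ε)) =
        ((q₀ + 2 : ℕ) : ℝ) ^ ε * ((q₀ + 2 : ℕ) : ℝ) ^ (-((3 : ℝ) / 2)) := by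
      rw [← Real.rpow_add hq0]; congr 1; ring
    rw [hsplit, ← mul_assoc]
    have hpos : (0 : ℝ) < ((q₀ + 2 : ℕ) : ℝ) ^ (-((3 : ℝ) / 2)) := Real.rpow_pos_of_pos hq0 _
    calc ((q₀ + 2 : ℕ) : ℝ) ^ (-((3 : ℝ) / 2))
        = 1 * ((q₀ + 2 : ℕ) : ℝ) ^ (-((3 : ℝ) / 2)) := (one_mul _).symm
      _ < c * ((q₀ + 2 : ℕ) : ℝ) ^ ε * ((q₀ + 2 : ℕ) : ℝ) ^ (-((3 : ℝ) / 2)) :=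
          mul_lt_mul_of_pos_right hcq hpos
  · have hqn : n ≤ (q₀ + 2) * n := Nat.le_mul_of_pos_left n (by omega)
    have key := hw n ((q₀ + 2) * n) hn hqn
    have hn0 : (n : ℝ) ≠ 0 := by exact_mod_cast (show n ≠ 0 by omega)
    have hdiv : (((q₀ + 2) * n : ℕ) : ℝ) / n = ((q₀ + 2 : ℕ) : ℝ) := by
      push_cast; field_simp
    rw [hdiv] at key
    exact key

/-- **WINDOW ⇔ one good scale factor**: `WindowBelowHalf` holds iff for some integer `q ≥ 2` the
`q`-adic axial ratio `G(q n e₁)/G(n e₁)` is bounded below, uniformly in `n ≥ 1`, by a constant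
strictly larger than `q^{-3/2}`. This is the finite-depth form that an `R`-uniform certificate of
the route (`CertifiedWindow` ∘ `CriticalStateFeasible`) would have to deliver. [folklore] -/
theorem windowBelowHalf_iff_scaleFactor :
    WindowBelowHalf ↔ ∃ (q : ℕ) (κ : ℝ), 2 ≤ q ∧ (q : ℝ) ^ (-((3 : ℝ) / 2)) < κ ∧
      ∀ n : ℕ, 1 ≤ n → κ * criticalTwoPoint 3 (Pi.single 0 (n : ℤ)) ≤
        criticalTwoPoint 3 (Pi.single 0 ((q * n : ℕ) : ℤ)) :=
  ⟨scaleFactor_of_windowBelowHalf, windowBelowHalf_of_scaleFactor⟩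

/-! ### WINDOW and the logarithmic exponent `η` -/

/-- **WINDOW sharpens Duminil-Copin–Panis 2025, Thm 1.5, to a strict inequality**: if
`WindowBelowHalf` holds and the anomalous dimension exists in the logarithmic sense of the source
(`HasIsingExponentEta 3 η`: `log G(x)/log ‖x‖ → -(1+η)` cofinitely), then `η < 1/2` — along the
axis `log G(n e₁)/log n ≥ log c/log n - (3/2 - ε) → -(3/2 - ε)`, so `η ≤ 1/2 - ε`. The printed
theorem (`dcp_isingEta_le_half_holds`) gives the non-strict `η ≤ 1/2` unconditionally; the strict
form is what the item adds on pure-power scenarios. [folklore] -/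
theorem isingEta_lt_half_of_windowBelowHalf (h : WindowBelowHalf) {η : ℝ}
    (hη : HasIsingExponentEta 3 η) : η < 1 / 2 := by
  obtain ⟨ε, c, hε, hc, hlow⟩ := axis_rpow_lower_of_windowBelowHalf h
  have h' : Tendsto (fun x : Site 3 => Real.log (criticalTwoPoint 3 x) / Real.log ‖x‖) cofinite
      (𝓝 (-(((3 : ℕ) : ℝ) - 2 + η))) := hη
  have he : (-(((3 : ℕ) : ℝ) - 2 + η)) = -(1 + η) := by norm_num
  rw [he] at h'
  -- along the axis `n e₁`
  have h1 : Tendsto (fun n : ℕ => Real.log (criticalTwoPoint 3 (Pi.single 0 (n : ℤ))) /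
      Real.log (n : ℝ)) atTop (𝓝 (-(1 + η))) := by
    refine (h'.comp tendsto_natCast_single_axis_cofinite).congr' (Eventually.of_forall fun n => ?_)
    simp only [Function.comp, norm_single_natCast]
  -- the lower-bound sequence `log c / log n - (3/2 - ε) → -(3/2 - ε)`
  have h2 : Tendsto (fun n : ℕ => Real.log c / Real.log (n : ℝ) - (3 / 2 - ε)) atTop
      (𝓝 (0 - (3 / 2 - ε))) :=
    (tendsto_const_nhds.div_atTop
      (Real.tendsto_log_atTop.comp tendsto_natCast_atTop_atTop)).sub_const _
  have hle : ∀ᶠ n : ℕ in atTop, Real.log c / Real.log (n : ℝ) - (3 / 2 - ε) ≤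
      Real.log (criticalTwoPoint 3 (Pi.single 0 (n : ℤ))) / Real.log (n : ℝ) := by
    filter_upwards [eventually_ge_atTop 2] with n hn
    have hn1 : (1 : ℝ) < n := by exact_mod_cast hn
    have hn0 : (0 : ℝ) < n := by linarith
    have hlogn : 0 < Real.log (n : ℝ) := Real.log_pos hn1
    have hG := hlow n (by omega)
    have hnpow : 0 < (n : ℝ) ^ (-((3 : ℝ) / 2 - ε)) := Real.rpow_pos_of_pos hn0 _
    have hlog : Real.log c + (-((3 : ℝ) / 2 - ε)) * Real.log (n : ℝ) ≤
        Real.log (criticalTwoPoint 3 (Pi.single 0 (n : ℤ))) := by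
      rw [← Real.log_rpow hn0, ← Real.log_mul hc.ne' hnpow.ne']
      exact Real.log_le_log (mul_pos hc hnpow) hG
    rw [le_div_iff₀ hlogn, sub_mul, div_mul_cancel₀ _ hlogn.ne']
    linarith
  have hlim := le_of_tendsto_of_tendsto h2 h1 hle
  linarith

/-! ### The milestone reading: `CertifiedWindow ∘ CriticalStateFeasible ⇒ WINDOW` -/

/-- **`WindowBelowHalf` from the route's crux and its feasibility input** (the "milestone" reading
of the item; this is the inner step of the route's deciding theorem `closes`, extracted verbatim as
a named lemma): for `1 ≤ m ≤ n` take the level `k·n` boundary law of `CriticalStateFeasible`,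
apply `CertifiedWindow` at `R = n`, and rewrite `E{0, j e₁} = G(j e₁)`, `j = m, n`. [folklore] -/
theorem windowBelowHalf_of_certifiedWindow (hCW : CertifiedWindow) (hF : CriticalStateFeasible) :
    WindowBelowHalf := by
  unfold WindowBelowHalf
  obtain ⟨cw, Cw, hcw, hCw, hFL⟩ := hF
  obtain ⟨ε, c, k, hε, hc, hk, hR⟩ := hCW cw Cw hcw hCw
  refine ⟨ε, c, hε, hc, fun m n hm hmn => ?_⟩
  obtain ⟨ν, hν, hrows, hEq⟩ := hFL (k * n)
  have hkn : n ≤ k * n := Nat.le_mul_of_pos_left n (by omega)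
  have hbox : ∀ N j : ℕ, j ≤ N → (Pi.single 0 (j : ℤ) : Site 3) ∈ box 3 N := by
    intro N j hj
    rw [mem_box]
    intro i
    by_cases hi : i = 0
    · subst hi
      simp only [Pi.single_eq_same]
      omega
    · simp only [Pi.single_eq_of_ne hi]
      omega
  have hwin : c * ((n : ℝ) / m) ^ (-((3:ℝ) / 2 - ε)) *
      (∫ η, isingCorr (zdGraph 3) (box 3 (k * n)) (criticalBeta 3) 0
        (BoundaryCondition.fixed η) {0, Pi.single 0 (m : ℤ)} ∂ν) ≤
      ∫ η, isingCorr (zdGraph 3) (box 3 (k * n)) (criticalBeta 3) 0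
        (BoundaryCondition.fixed η) {0, Pi.single 0 (n : ℤ)} ∂ν :=
    hR n ν hν hrows m n hm hmn le_rfl
  have hEm : (∫ η, isingCorr (zdGraph 3) (box 3 (k * n)) (criticalBeta 3) 0
        (BoundaryCondition.fixed η) {0, Pi.single 0 (m : ℤ)} ∂ν) =
      criticalTwoPoint 3 (Pi.single 0 (m : ℤ)) :=
    hEq _ (hbox (k * n) m (hmn.trans hkn)) (single_natCast_ne_zero hm)
  have hEn : (∫ η, isingCorr (zdGraph 3) (box 3 (k * n)) (criticalBeta 3) 0
        (BoundaryCondition.fixed η) {0, Pi.single 0 (n : ℤ)} ∂ν) =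
      criticalTwoPoint 3 (Pi.single 0 (n : ℤ)) :=
    hEq _ (hbox (k * n) n hkn) (single_natCast_ne_zero (hm.trans hmn))
  rw [hEm, hEn] at hwin
  exact hwin

end Summit.CriticalPhenomena.Ising3DConformalLimit.Theorems
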